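import Summits.CriticalPhenomena.PercolationContinuityZ3.Theorems.PercNearOneGluingNoHeavyQuantLightPairBlobForest
import HarnessLib

/-!
# QUANT lane R8, T-DEC: THE GLUED SIBLING AND THE GLUED PAIR ARE TREE-BUILT AT EVERY FLOOR BELOW THE NATURAL ONE — so the light node
# `TreeBuiltCatHullLight` PREDICTS hull membership of `lpT c q s` at every floor `x < qs` whenever `x < 1/2` (the exact test the census runs)

builds on p205010 (kernel theorem, internal audit signed; external expert review pending)

Support file (`--supports stmt-CriticalPhenomena-4575`), QUANT lane census seat prim-quant-census-2 (gen 77), rung R8 of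
`run/shared/lean/prim/quant/LADDER.md`.  Theorems only; standard axioms, no sorries.

WHAT.  Census-2 g76/g77's membership theorems for the family `lpT c q s = (R¹[q](R^c[s]))²` (`…QuantLightPairCatHull*`, `…QuantCatHullSmallGates`,
`…QuantLightPairBlobForest*`, `…QuantLightPairLightRoot`) carry the light node on the family in the form "for every tree-built presentation
`TreeBuilt x M (lpT c q s)` with `x ≤ qs` …".  This file supplies the presentations: the sibling `lpSib c q s = gate_q(δ₁ ∗ gate_s δ_c)` and the pair
are `TreeBuilt` at EVERY floor `0 < x < qs` (`treeBuilt_lpSib`, `treeBuilt_lpT`; relays at floor `x/(qs) < 1`, `treeBuilt_gate_pointLaw`,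
`TreeBuilt.conv/gate`), hence **`lpT_inGatedCatHull_of_treeBuiltCatHullLight`: the node `TreeBuiltCatHullLight` implies
`InGatedCatHull x (2q(1+cs)) (2c+2) (lpT c q s)` for every `0 < x < qs` with `x < 1/2`** — the precise prediction that census-2 g77's near-boundary
census tests; and `lpT_inGatedCatHull_of_catPairLight`: (P) `CatPairLight` predicts membership at every floor `y ≤ qs`, the natural floor INCLUDED; `not_catPairLight_of_corner_out` / `not_treeBuiltCatHullLight_of_corner_out`: the two negations REDUCE to single concrete non-memberships of `lpT 4 (3/5) (49/60)` (floors `49/100` resp. `39/80`) — the statements census-2 g77's certified OUT verdicts assert (memo `run/shared/lean/prim/quant/prim-quant-census-2-g77/CENSUS-PAIRMAP-G77.md` §4: at `q ∈ [.55, .7]`, `c ∈ {3,4}`, `qs = .49` the free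
gated-caterpillar tiers find the pair OUT at the floor `.49` itself and IN at `.48`; the floors in between decide the node).
HONEST STATUS.  Bookkeeping; `TreeBuiltCatHullLight`, `CatPairLight`, `SiblingStep`, `FarTreeRow` remain OPEN (the first two under adverse census at
the corner above); RATE class log\* / honest sentence of `run/shared/lean/prim/quant/README.md` unchanged.  [this work]; `lpT`: prim-quant-census-2 g76;
`treeBuilt_gate_pointLaw`: this lane (`…QuantTreeRowFloorThreshold`).  Nothing here is cited as a published result.  The gluing rows served
[cite: KozmaNitzan2024, Conjecture 3 (p. 15)]; product measure [cite: Grimmett1999, §1.3 p. 10].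
-/

noncomputable section

open scoped BigOperators

namespace Summit.CriticalPhenomena.PercolationContinuityZ3.Theorems
namespace Quant
namespace LawDec

open Finset

/-- **the glued sibling is tree-built at every floor below its least marginal**: `0 < q ≤ 1`, `0 < s ≤ 1`, `0 < x < qs` ⟹
`TreeBuilt x (c+1) (lpSib c q s)`. [this work] -/
theorem treeBuilt_lpSib (c : ℕ) (q s x : ℝ) (hq0 : 0 < q) (hq1 : q ≤ 1) (hs1 : s ≤ 1) (hx0 : 0 < x) (hx : x < q * s) :
    TreeBuilt x (c + 1) (lpSib c q s) := by
  have hxq0 : 0 < x / q := div_pos hx0 hq0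
  have hxq : x / q < s := by rw [div_lt_iff₀ hq0]; linarith [mul_comm q s]
  have hxq1 : x / q < 1 := lt_of_lt_of_le hxq hs1
  have hb : TreeBuilt (x / q) c (gate (pointLaw c) s) := treeBuilt_gate_pointLaw (x / q) s hxq0 hxq hs1 c
  have hr : TreeBuilt (x / q) 1 (pointLaw 1) := TreeBuilt.relay (x / q) hxq0 hxq1
  have hc := TreeBuilt.conv hr hb
  have hv : ∀ h, 1 < h → pointLaw 1 h = 0 := fun h hh => by rw [pointLaw_apply, if_neg (by omega)]
  have e : lconv 1 c (pointLaw 1) (gate (pointLaw c) s) = slice (pointLaw 1) c s := lconv_gate_point_eq_slice 1 c (pointLaw 1) s hv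
  rw [e, Nat.add_comm] at hc
  have hg := TreeBuilt.gate q hq0 hq1 hc
  have ex : q * (x / q) = x := by field_simp
  rw [ex] at hg
  exact hg

/-- **the glued pair is tree-built at every floor below its natural floor**: `0 < x < qs` ⟹ `TreeBuilt x (2c+2) (lpT c q s)`. [this work] -/
theorem treeBuilt_lpT (c : ℕ) (q s x : ℝ) (hq0 : 0 < q) (hq1 : q ≤ 1) (hs1 : s ≤ 1) (hx0 : 0 < x) (hx : x < q * s) :
    TreeBuilt x (2 * c + 2) (lpT c q s) := by
  have h := TreeBuilt.conv (treeBuilt_lpSib c q s x hq0 hq1 hs1 hx0 hx) (treeBuilt_lpSib c q s x hq0 hq1 hs1 hx0 hx)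
  rw [show c + 1 + (c + 1) = 2 * c + 2 by ring] at h
  exact h

/-- **WHAT THE LIGHT NODE PREDICTS FOR THE FAMILY**: under `TreeBuiltCatHullLight`, for every `c`, `0 < q ≤ 1`, `0 < s ≤ 1` and every floor
`0 < x < qs` with `x < 1/2`, the pair `lpT c q s` is a member of the gated caterpillar hull at `(x, 2q(1+cs), 2c+2)`.  A single `(c, q, s, x)` in
this range with `lpT c q s ∉ FH(x, 2q(1+cs), 2c+2)` refutes the node. [this work] -/
theorem lpT_inGatedCatHull_of_treeBuiltCatHullLight (hL : TreeBuiltCatHullLight) (c : ℕ) (q s x : ℝ) (hq0 : 0 < q) (hq1 : q ≤ 1)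
    (hs1 : s ≤ 1) (hx0 : 0 < x) (hx : x < q * s) (hxh : x < 1 / 2) :
    InGatedCatHull x (2 * q * (1 + c * s)) (2 * c + 2) (lpT c q s) := by
  have key := hL x (2 * c + 2) (lpT c q s) (treeBuilt_lpT c q s x hq0 hq1 hs1 hx0 hx) hxh
  rwa [lpT_mean] at key

/-- the same from the pair lemma's three-way split is not needed; for the record, the node's prediction at the census's instances:
e.g. `c = 4`, `q = 3/5`, `s = 49/60` (natural floor `qs = 49/100 < 1/2`): membership at EVERY floor `x < 49/100`. [this work] -/
theorem lpT_inGatedCatHull_of_treeBuiltCatHullLight_ex (hL : TreeBuiltCatHullLight) (x : ℝ) (hx0 : 0 < x) (hx : x < 49 / 100) :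
    InGatedCatHull x (2 * (3 / 5 : ℝ) * (1 + (4 : ℕ) * (49 / 60 : ℝ))) (2 * 4 + 2) (lpT 4 (3 / 5) (49 / 60)) :=
  lpT_inGatedCatHull_of_treeBuiltCatHullLight hL 4 (3 / 5) (49 / 60) x (by norm_num) (by norm_num) (by norm_num) hx0
    (by norm_num at hx ⊢; linarith) (by linarith)

/-- **WHAT THE PAIR LEMMA (P) PREDICTS FOR THE FAMILY — INCLUDING THE NATURAL FLOOR ITSELF.**  Under `CatPairLight`, for every `c`, `0 < q ≤ 1`,
`0 < s ≤ 1` and every floor `0 < y ≤ qs` with `y < 1/2` and `y < q`: `lpT c q s ∈ FH(y, 2q(1+cs), 2c+2)` (columns `gate_q ρ`, `ρ = δ₁ ∗ blob(c,s)` a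
caterpillar at floor `y/q ≤ s`).  Unlike the node (tree-built floors are `< qs`), (P) reaches `y = qs` exactly: an OUT of the pair AT its natural light
floor refutes (P) as typed (census-2 g77 memo CENSUS-PAIRMAP-G77 §4: `c = 4`, `q = 3/5`, `s = 49/60`, `y = qs = 49/100`). [this work] -/
theorem lpT_inGatedCatHull_of_catPairLight (hP : CatPairLight) (c : ℕ) (q s y : ℝ) (hq1 : q ≤ 1) (hs1 : s ≤ 1) (hy0 : 0 < y)
    (hyq : y < q) (hy : y ≤ q * s) (hyh : y < 1 / 2) :
    InGatedCatHull y (2 * q * (1 + c * s)) (2 * c + 2) (lpT c q s) := by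
  have hq0 : 0 < q := hy0.trans hyq
  have hρ : CatBuilt (y / q) (c + 1) (slice (pointLaw 1) c s) :=
    cat_lpRho c s (y / q) (div_pos hy0 hq0) ((div_lt_one hq0).2 hyq) (by rw [div_le_iff₀ hq0]; linarith [mul_comm q s]) hs1
  have key := hP y q q (c + 1) (c + 1) _ _ hy0 hyh hyq hq1 hyq hq1 hρ hρ
  rw [lpRho_mean] at key
  rw [show 2 * c + 2 = c + 1 + (c + 1) by omega, show 2 * q * (1 + c * s) = q * (1 + c * s) + q * (1 + c * s) by ring]
  exact key

/-- the census instance: (P) predicts `lpT 4 (3/5) (49/60) ∈ FH(49/100, 2·(3/5)·(1 + 4·49/60), 10)` — membership AT the natural floor `49/100`.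
[this work] -/
theorem lpT_inGatedCatHull_of_catPairLight_ex (hP : CatPairLight) :
    InGatedCatHull ((49 : ℝ) / 100) (2 * (3 / 5 : ℝ) * (1 + (4 : ℕ) * (49 / 60 : ℝ))) (2 * 4 + 2) (lpT 4 (3 / 5) (49 / 60)) :=
  lpT_inGatedCatHull_of_catPairLight hP 4 (3 / 5) (49 / 60) (49 / 100) (by norm_num) (by norm_num) (by norm_num) (by norm_num)
    (by norm_num) (by norm_num)

/-! ### The refutation targets, as single non-membership statements -/

/-- **WHAT A KERNEL REFUTATION OF (P) NEEDS**: the single non-membership `lpT 4 (3/5) (49/60) ∉ FH(49/100, 128/25, 10)` (census-2 g77: OUT of the gated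
caterpillar hull at the natural floor, B&B-certified for the free tiers; memo CENSUS-PAIRMAP-G77 §4) implies `¬ CatPairLight`. [this work] -/
theorem not_catPairLight_of_corner_out
    (hout : ¬ InGatedCatHull ((49 : ℝ) / 100) ((128 : ℝ) / 25) 10 (lpT 4 (3 / 5) (49 / 60))) : ¬ CatPairLight := by
  intro hP
  apply hout
  have key := lpT_inGatedCatHull_of_catPairLight_ex hP
  have e : 2 * (3 / 5 : ℝ) * (1 + (4 : ℕ) * (49 / 60 : ℝ)) = 128 / 25 := by norm_num
  rwa [e] at key

/-- **WHAT A KERNEL REFUTATION OF THE NODE NEEDS**: the single non-membership `lpT 4 (3/5) (49/60) ∉ FH(39/80, 128/25, 10)` (floor `39/80 = .4875`,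
below the natural floor `.49`; census-2 g77 kit j270433: OUT, B&B-certified for the tiers BB ∪ CAT2 ∪ CAT3, margin 2.69e-3) implies
`¬ TreeBuiltCatHullLight`. [this work] -/
theorem not_treeBuiltCatHullLight_of_corner_out
    (hout : ¬ InGatedCatHull ((39 : ℝ) / 80) ((128 : ℝ) / 25) 10 (lpT 4 (3 / 5) (49 / 60))) : ¬ TreeBuiltCatHullLight := by
  intro hL
  apply hout
  have key := lpT_inGatedCatHull_of_treeBuiltCatHullLight_ex hL (39 / 80) (by norm_num) (by norm_num)
  have e : 2 * (3 / 5 : ℝ) * (1 + (4 : ℕ) * (49 / 60 : ℝ)) = 128 / 25 := by norm_num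
  rwa [e] at key

end LawDec
end Quant
end Summit.CriticalPhenomena.PercolationContinuityZ3.Theorems
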